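import Summits.BirchSwinnertonDyer.Rank1Residual.X1.MuLambdaAlgebra
import HarnessLib

/-!
# `Λ`-algebra for the crux `SignedTransportAtTwo` (stmt-BirchSwinnertonDyer-20333, route `ThetaPartnerAtTwo`, line
# `bridge`): a congruence modulo `p` up to a `p`-adic unit TRANSFERS `μ` and EQUATES `λ`
# (lead prover bsd-wall-tp2-p1 g2; `--supports stmt-BirchSwinnertonDyer-20333`; route-independent, closes nothing)

HONEST FRAMING. Pure algebra in `Λ = ℤ_p⟦T⟧` for any prime `p`; nothing about any curve is asserted.

This is the passage Greenberg–Vatsal (Invent. Math. 142 (2000), §1 p. 9 and Thm. (1.6)) and Emerton–Pollack–Weston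
(Invent. Math. 163 (2006), Thm. 1) make from ONE congruence of (non-primitive) `p`-adic `L`-functions,
`L_{Σ₀}(E₁) ≡ u·L_{Σ₀}(E₂) (mod p)`, to "`μ = 0` transfers and the `λ`-invariants agree": if
`p^{m'}·F − u·p^{m}·F_A ∈ p^{m+m'+1}Λ` for a unit `u ∈ ℤ_pˣ` and `F_A ≠ 0` has `μ(F_A) = m'`, then `F ≠ 0`, `μ(F) = m` and
`λ(F) = λ(F_A)` (`ne_zero_mu_lam_of_congr`). The exponents `m, m'` let the statement be applied to INTEGRAL MULTIPLES
`F = p^m·(…)`, `F_A = p^{m'}·(…)` of functions that live in `Λ ⊗ ℚ_p` (the tree's Néron-normalised signed functions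
`2^m ϖ L♭`). Used at `p = 2` by `Theorems/ThetaPartnerAtTwoSignedTransportAtTwoBridgeCongruence.lean`. No sorry; standard axioms.

References: [GreenbergVatsal2000] §1 p. 9, Thm. (1.6); [EmertonPollackWeston2006] Thm. 1; [Washington1997] §7.1, §13.1.
-/

set_option autoImplicit false
-- D-0017: single-problem summit, so `Summit.BirchSwinnertonDyer.BirchSwinnertonDyer.…` repeats a namespace BY DESIGN.
set_option linter.dupNamespace false

noncomputable section

open scoped Classical

open Literature.NumberTheory.EllipticCurves Summit.BirchSwinnertonDyer.Rank1Residual.X1.MuLambda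

namespace Summit.BirchSwinnertonDyer.BirchSwinnertonDyer.Theorems.SignedTransportAtTwo

/-! ## A congruence modulo `p` up to a unit transfers `μ` and equates `λ` -/

section Algebra

variable {p : ℕ} [Fact p.Prime]

/-- `red (C p * q) = 0`. [cite: Washington1997, §13.1] -/
theorem red_C_p_mul (q : IwasawaAlgebra p) : red (PowerSeries.C (p : ℤ_[p]) * q) = 0 :=
  (red_eq_zero_iff _).mpr ⟨q, rfl⟩

/-- `red (C u * g) = C ū * red g` with `ū ≠ 0` for a unit `u ∈ ℤ_pˣ`; in particular `red (C u * g) ≠ 0 ↔ red g ≠ 0`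
and the orders agree. [cite: Washington1997, §7.1] -/
theorem red_C_unit_mul (u : ℤ_[p]ˣ) (g : IwasawaAlgebra p) :
    red (PowerSeries.C (u : ℤ_[p]) * g) = PowerSeries.C (IsLocalRing.residue ℤ_[p] (u : ℤ_[p])) * red g ∧
      IsLocalRing.residue ℤ_[p] (u : ℤ_[p]) ≠ 0 := by
  refine ⟨by rw [red, map_mul, PowerSeries.map_C], ?_⟩
  exact (u.isUnit.map (IsLocalRing.residue ℤ_[p])).ne_zero

/-- Multiplying by `C a`, `a ≠ 0` in a field, does not change the order of a power series. [folklore] -/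
theorem order_C_mul_of_ne_zero {k : Type*} [Field k] {a : k} (ha : a ≠ 0) (φ : PowerSeries k) :
    (PowerSeries.C a * φ).order = φ.order := by
  rw [PowerSeries.order_mul, ← PowerSeries.monomial_zero_eq_C_apply, PowerSeries.order_monomial_of_ne_zero 0 a ha,
    Nat.cast_zero, zero_add]

/-- **A congruence modulo `p` up to a unit transfers `μ` and equates `λ`** (the `Λ`-algebra of Greenberg–Vatsal p. 9 /
Emerton–Pollack–Weston Thm. 1): in `Λ = ℤ_p⟦T⟧`, if `p^{m'}·F − u·p^{m}·F_A ∈ p^{m+m'+1}Λ` for a unit `u ∈ ℤ_pˣ` and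
`F_A ≠ 0` has `μ(F_A) = m'`, then `F ≠ 0`, `μ(F) = m` and `λ(F) = λ(F_A)`. (Write `F_A = p^{m'}F_A⁰`, `F_A⁰ ≢ 0 (mod p)`;
cancelling `p^{m'}` gives `F = p^m·(u F_A⁰ + p q)` and `u F_A⁰ + p q ≡ u F_A⁰ ≢ 0 (mod p)` has the order of `F_A⁰ mod p`.)
[cite: GreenbergVatsal2000, §1 p. 9 and Thm. (1.6)] [cite: EmertonPollackWeston2006, Thm. 1] -/
theorem ne_zero_mu_lam_of_congr {F FA : IwasawaAlgebra p} {m m' : ℕ} (u : ℤ_[p]ˣ) (hFA : FA ≠ 0) (hμA : mu FA = m')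
    (hcong : PowerSeries.C ((p : ℤ_[p]) ^ (m + m' + 1)) ∣
      PowerSeries.C ((p : ℤ_[p]) ^ m') * F - PowerSeries.C ((u : ℤ_[p]) * (p : ℤ_[p]) ^ m) * FA) :
    F ≠ 0 ∧ mu F = m ∧ lam F = lam FA := by
  obtain ⟨q, hq⟩ := hcong
  -- `F_A = p^{m'} · F_A⁰`, `F_A⁰ = pfree F_A ≢ 0 (mod p)`
  have hFAfac : FA = PowerSeries.C ((p : ℤ_[p]) ^ m') * pfree FA := by
    conv_lhs => rw [eq_C_pow_mu_mul_pfree FA, hμA]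
  have hredA : red (pfree FA) ≠ 0 := red_pfree_ne_zero hFA
  -- cancel `p^{m'}`: `F = p^m · F₀`, `F₀ = u · F_A⁰ + p · q`
  set F₀ : IwasawaAlgebra p := PowerSeries.C (u : ℤ_[p]) * pfree FA + PowerSeries.C (p : ℤ_[p]) * q with hF₀
  have hF : F = PowerSeries.C ((p : ℤ_[p]) ^ m) * F₀ := by
    have key : PowerSeries.C ((p : ℤ_[p]) ^ m') * F =
        PowerSeries.C ((p : ℤ_[p]) ^ m') * (PowerSeries.C ((p : ℤ_[p]) ^ m) * F₀) := by
      have h1 : PowerSeries.C ((p : ℤ_[p]) ^ m') * F =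
          PowerSeries.C ((u : ℤ_[p]) * (p : ℤ_[p]) ^ m) * FA + PowerSeries.C ((p : ℤ_[p]) ^ (m + m' + 1)) * q := by
        rw [← hq]; ring
      rw [h1, hF₀]
      conv_lhs => rw [hFAfac]
      simp only [map_mul, map_pow, pow_add, pow_one]
      ring
    exact mul_left_cancel₀ (C_pow_ne_zero m') key
  -- `F₀ ≡ u · F_A⁰ (mod p)`, non-zero of the same order
  obtain ⟨hredu, hu0⟩ := red_C_unit_mul u (pfree FA)
  have hredF₀ : red F₀ = PowerSeries.C (IsLocalRing.residue ℤ_[p] (u : ℤ_[p])) * red (pfree FA) := by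
    rw [hF₀, red, map_add, ← red, ← red, hredu, red_C_p_mul, add_zero]
  have hredF₀ne : red F₀ ≠ 0 := by
    rw [hredF₀]
    exact mul_ne_zero ((map_ne_zero_iff _ PowerSeries.C_injective).mpr hu0) hredA
  obtain ⟨hμF, hpfreeF⟩ := mu_eq_and_pfree_eq hredF₀ne hF
  have hF₀ne : F₀ ≠ 0 := by
    rintro h0
    exact hredF₀ne (by rw [h0, red, map_zero])
  refine ⟨by rw [hF]; exact mul_ne_zero (C_pow_ne_zero m) hF₀ne, hμF, ?_⟩
  rw [lam, lam, hpfreeF, hredF₀, order_C_mul_of_ne_zero hu0]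

end Algebra

end Summit.BirchSwinnertonDyer.BirchSwinnertonDyer.Theorems.SignedTransportAtTwo

end
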